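import Summits.AtomisticToContinuum.HydrodynamicLimit.Theorems.OneFlightGossipEngineEnergyActivityTailsRecordGain
import Summits.AtomisticToContinuum.HydrodynamicLimit.Theorems.OneFlightGossipEngineEnergyActivityTailsCoboundary
import Summits.AtomisticToContinuum.HydrodynamicLimit.Theorems.OneFlightGossipEngineEnergyActivityTailsPathwiseSplit
import Summits.AtomisticToContinuum.HydrodynamicLimit.Theorems.OneFlightGossipEngineEnergyActivityTailsHotSupplyMeasurable
import Summits.AtomisticToContinuum.HydrodynamicLimit.Theorems.OneFlightGossipEngineEnergyActivityTailsTailAssembly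
import Summits.AtomisticToContinuum.HydrodynamicLimit.Theorems.OneFlightGossipEngineEnergyActivityTailsHotSupplyRungs
import HarnessLib

/-!
# `EnergyActivityTails` (stmt-17703) from its two leaves `CollisionActivityTails` (stmt-13734) and `HotSupplyTailsIn`

Glue over LANDED theorems only (no `sorry`, no new hypothesis): the line `Sketch` (coboundary-hot-cold-split) of crux
`Summit.AtomisticToContinuum.HydrodynamicLimit.Theses.OneFlightGossipEngine.EnergyActivityTails` (EAT, stmt-17703) landed its
closable stubs in five separate files, each re-declaring the line vocabulary (`hotSupplyOf`, `gainOf`, `RecordGain`,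
`Coboundary`, `PathwiseSplit`, `HotSupplyMeasurable`, `HotSupplyTailsIn`) verbatim in its own namespace:

* K1 `EnergyActivityTailsRecordGain.stub_recordGain : RecordGain`,
* K2 `EnergyActivityTailsCoboundary.stub_coboundary : Coboundary`,
* K3 `EnergyActivityTailsPathwiseSplit.stub_pathwiseSplit : RecordGain → Coboundary → PathwiseSplit`,
* `EnergyActivityTailsHotSupplyMeasurable.stub_hotSupplyMeasurable : HotSupplyMeasurable`,
* K4 `EnergyActivityTailsTailAssembly.stub_tailAssembly : PathwiseSplit → HotSupplyMeasurable → CAT → HotSupplyTailsIn → EAT`.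

The copies are separate constants with byte-identical bodies, hence definitionally equal after `δ`-unfolding; this file
identifies them (`Iff.rfl` / term-mode coercions) and composes: **`energyActivityTails_of_leaves : CAT → HotSupplyTailsIn → EAT`**
and, with the landed converse `EnergyActivityTailsHotSupplyRungs.hotSupplyTailsIn_of_energyActivityTails`,
**`energyActivityTails_iff_hotSupplyTailsIn : CAT → (EAT ↔ HotSupplyTailsIn)`** — modulo its momentum twin CAT, the crux
EAT is EQUIVALENT to its single registered open leaf.  The canonical copy of the leaf used in the headline statements is
`EnergyActivityTailsHotSupplyRungs.HotSupplyTailsIn` (the file that studies the leaf: domination, monotonicity in the cap,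
equilibrium rung).

Used by the cone of `ImplosionDichotomy.HydroLimitProfilewiseBand` (stmt-17372) / `HydroLimitInBand` (stmt-9133), whose
registered stub `stub_items4` carries EAT as a conjunct: the conjunct is now CAT ∧ `HotSupplyTailsIn` up to landed theorems.

References (context only; every step here is definitional plumbing over landed files): C. Cercignani, R. Illner,
M. Pulvirenti, *The Mathematical Theory of Dilute Gases* (1994), §4.2; H. Spohn, *Large Scale Dynamics of Interacting
Particles* (1991), Part I §2.3.
-/

noncomputable section

open MeasureTheory Filter Set Topology
open scoped ENNReal InnerProductSpace

namespace Summit.AtomisticToContinuum.HydrodynamicLimit.Theorems.EnergyActivityTailsOfLeaves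

open Literature.MathematicalPhysics.KineticTheory Literature.Analysis.FluidPDE
open Summit.AtomisticToContinuum.HydrodynamicLimit.Theses.OneFlightGossipEngine (EnergyActivityTails CollisionActivityTails)
open Summit.AtomisticToContinuum.HydrodynamicLimit.Theorems

/-! ## §1 Identification of the verbatim copies (all `Iff.rfl`: the bodies coincide after `δ`-unfolding) -/

/-- The `RecordGain` of the K1 file is the `RecordGain` consumed by K3. [folklore] -/
theorem recordGain_iff :
    EnergyActivityTailsRecordGain.RecordGain ↔ EnergyActivityTailsPathwiseSplit.RecordGain := Iff.rfl

/-- The `Coboundary` of the K2 file is the `Coboundary` consumed by K3 (the two `gainOf` copies coincide). [folklore] -/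
theorem coboundary_iff :
    EnergyActivityTailsCoboundary.Coboundary ↔ EnergyActivityTailsPathwiseSplit.Coboundary := Iff.rfl

/-- The `PathwiseSplit` produced by K3 is the `PathwiseSplit` consumed by K4 (the two `hotSupplyOf` copies coincide).
[folklore] -/
theorem pathwiseSplit_iff :
    EnergyActivityTailsPathwiseSplit.PathwiseSplit ↔ EnergyActivityTailsTailAssembly.PathwiseSplit := Iff.rfl

/-- The `HotSupplyMeasurable` of the measurability file is the one consumed by K4. [folklore] -/
theorem hotSupplyMeasurable_iff :
    EnergyActivityTailsHotSupplyMeasurable.HotSupplyMeasurable ↔ EnergyActivityTailsTailAssembly.HotSupplyMeasurable :=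
  Iff.rfl

/-- The leaf `HotSupplyTailsIn` of the rungs file is the one consumed by K4. [folklore] -/
theorem hotSupplyTailsIn_iff :
    EnergyActivityTailsHotSupplyRungs.HotSupplyTailsIn ↔ EnergyActivityTailsTailAssembly.HotSupplyTailsIn := Iff.rfl

/-! ## §2 The landed closable stubs, discharged in the vocabulary of K4 -/

/-- **K3 holds**: the pathwise split, from the landed K1 (record gain bound) and K2 (coboundary). [folklore] -/
theorem pathwiseSplit_holds : EnergyActivityTailsTailAssembly.PathwiseSplit :=
  pathwiseSplit_iff.1
    (EnergyActivityTailsPathwiseSplit.stub_pathwiseSplit (recordGain_iff.1 EnergyActivityTailsRecordGain.stub_recordGain)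
      (coboundary_iff.1 EnergyActivityTailsCoboundary.stub_coboundary))

/-- **The hot-supply window sum is measurable in the datum** (landed), in the vocabulary of K4. [folklore] -/
theorem hotSupplyMeasurable_holds : EnergyActivityTailsTailAssembly.HotSupplyMeasurable :=
  hotSupplyMeasurable_iff.1 EnergyActivityTailsHotSupplyMeasurable.stub_hotSupplyMeasurable

/-! ## §3 The crux from its two leaves -/

/-- **EAT from CAT and the hot-supply tails** — the composition of line `Sketch` of stmt-17703 with every closable stub
discharged by its landed proof: `CollisionActivityTails → HotSupplyTailsIn → EnergyActivityTails` (route decls BY NAME;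
the leaf in the vocabulary of `EnergyActivityTailsHotSupplyRungs`). [folklore] -/
theorem energyActivityTails_of_leaves :
    Summit.AtomisticToContinuum.HydrodynamicLimit.Theses.OneFlightGossipEngine.CollisionActivityTails →
      Summit.AtomisticToContinuum.HydrodynamicLimit.Theorems.EnergyActivityTailsHotSupplyRungs.HotSupplyTailsIn →
        Summit.AtomisticToContinuum.HydrodynamicLimit.Theses.OneFlightGossipEngine.EnergyActivityTails :=
  fun hC hH =>
    EnergyActivityTailsTailAssembly.stub_tailAssembly pathwiseSplit_holds hotSupplyMeasurable_holds hC
      (hotSupplyTailsIn_iff.1 hH)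

/-- The same with the leaf in the vocabulary of the K4 file `EnergyActivityTailsTailAssembly`. [folklore] -/
theorem energyActivityTails_of_leaves' (hC : CollisionActivityTails)
    (hH : EnergyActivityTailsTailAssembly.HotSupplyTailsIn) : EnergyActivityTails :=
  EnergyActivityTailsTailAssembly.stub_tailAssembly pathwiseSplit_holds hotSupplyMeasurable_holds hC hH

/-- **Modulo its momentum twin, EAT is EQUIVALENT to its registered open leaf**:
`CollisionActivityTails → (EnergyActivityTails ↔ HotSupplyTailsIn)` (the converse is the landed domination
`hotSupplyTailsIn_of_energyActivityTails`, cap `M := 1`). [folklore] -/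
theorem energyActivityTails_iff_hotSupplyTailsIn (hC : CollisionActivityTails) :
    EnergyActivityTails ↔ EnergyActivityTailsHotSupplyRungs.HotSupplyTailsIn :=
  ⟨EnergyActivityTailsHotSupplyRungs.hotSupplyTailsIn_of_energyActivityTails, energyActivityTails_of_leaves hC⟩

/-- **The pair (CAT, EAT) is the pair (CAT, HotSupplyTailsIn)**: the conjunction consumed by the docks (TransferActivityTails =
CAT ∧ EAT, `stub_items4` of the 9133 / 17372 lines) in leaf form. [folklore] -/
theorem cat_and_eat_iff_cat_and_hotSupplyTailsIn :
    (CollisionActivityTails ∧ EnergyActivityTails) ↔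
      (CollisionActivityTails ∧ EnergyActivityTailsHotSupplyRungs.HotSupplyTailsIn) :=
  ⟨fun h => ⟨h.1, EnergyActivityTailsHotSupplyRungs.hotSupplyTailsIn_of_energyActivityTails h.2⟩,
    fun h => ⟨h.1, energyActivityTails_of_leaves h.1 h.2⟩⟩

end Summit.AtomisticToContinuum.HydrodynamicLimit.Theorems.EnergyActivityTailsOfLeaves

end
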